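import Summits.KontsevichZagierPeriods.KontsevichZagierPeriods.Theorems.MzvKernelInKZTwoPosetsCubicalChart
import Summits.KontsevichZagierPeriods.KontsevichZagierPeriods.Theorems.MzvKernelInKZTwoPosetsStuffleComb
import Summits.KontsevichZagierPeriods.KontsevichZagierPeriods.Theorems.FurushoPentagonHoffmanRelationInKZCubicalTransportAux

/-!
# `MzvKernelInKZ` (stmt-KontsevichZagierPeriods-3914), line two-posets-interior-landen: consecutive blocks and the cubical block formula

Lead's first helper towards the registered stub `stub_stuffleProduct` (the KZ side of the stuffle
product, built on worker G's `StuffleComb` and the landed `CubicalChart`). Contents: the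
consecutive coordinate blocks `cblocks n s` of an index `s` (non-dependent: blocks inside `Fin n`
from an offset, so that no cast along `|k :: s| = k + |s|` is ever needed) and their list
bookkeeping (block lengths, no repeated coordinate, non-empty blocks, RECONSTRUCTION of a block
pattern from the consecutive blocks of its length vector read through the enumeration of its
concatenation); the cumulative block products as truncated products; and THE CUBICAL BLOCK FORMULA
on the open cube, `cubicalFun (bword |s| s) 1 x = gfun x 1 (cblocks |s| s) / ∏ⱼ xⱼ` — Kontsevich's
word integrand of `ζ(s)` pulled back along the monomial chart, times its Jacobian, is the cubical
generating function of the blocks divided by the full monomial — obtained from the tree's blockwise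
pull-back identity `FurushoPentagon.HoffmanRelationInKZ.stub_cubicalPullback`.

Sources: M. Kontsevich, D. Zagier, *Periods* (2001), §1.2 rule (2); I. Soudères, *Motivic double
shuffle*, Int. J. Number Theory 6 (2010), §1.3 (cubical coordinates); M. E. Hoffman, J. Algebra
194 (1997), §2.
-/

noncomputable section

namespace Summit.KontsevichZagierPeriods.MzvKernelInKZ.TwoPosets

open Set MeasureTheory
open Literature.NumberTheory.Transcendental
open Summit.KontsevichZagierPeriods.MzvKernelInKZ.Negative

/-! ## Consecutive coordinate blocks -/

/-- The coordinates `m, m+1, …, m+k-1` of `Fin n` (those beyond the dimension are dropped). -/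
def rangeBlock (n m k : ℕ) : List (Fin n) :=
  (List.range' m k).filterMap fun j => if h : j < n then some ⟨j, h⟩ else none

/-- The consecutive coordinate blocks of an index `s = (s₁,…,s_r)` inside `Fin n`, starting at the
offset `m`: block `i` lists the `sᵢ` coordinates `m+s₁+⋯+s_{i-1}, …, m+s₁+⋯+sᵢ-1`. -/
def cblocksFrom (n : ℕ) : ℕ → List ℕ → List (List (Fin n))
  | _, [] => []
  | m, k :: s => rangeBlock n m k :: cblocksFrom n (m + k) s

/-- The consecutive coordinate blocks of an index inside `Fin n` (used with `n = |s|`). -/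
def cblocks (n : ℕ) (s : List ℕ) : List (List (Fin n)) := cblocksFrom n 0 s

variable {n : ℕ}

/-- The empty index has no blocks. -/
@[simp] theorem cblocksFrom_nil (m : ℕ) : cblocksFrom n m [] = [] := rfl

/-- The blocks of `k :: s` from offset `m`: the range block `[m, m+k)`, then the blocks of `s` from `m + k`. -/
theorem cblocksFrom_cons (m k : ℕ) (s : List ℕ) :
    cblocksFrom n m (k :: s) = rangeBlock n m k :: cblocksFrom n (m + k) s := rfl

/-- Inside the dimension the range block keeps every coordinate: its values are `m, …, m+k-1`. -/
theorem map_val_rangeBlock {m k : ℕ} (h : m + k ≤ n) :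
    (rangeBlock n m k).map Fin.val = List.range' m k := by
  unfold rangeBlock
  induction k generalizing m with
  | zero => simp
  | succ k ih =>
    rw [List.range'_succ, List.filterMap_cons, dif_pos (by omega)]
    simp only [List.map_cons]
    rw [ih (by omega)]

/-- Inside the dimension the range block has length `k`. -/
theorem length_rangeBlock {m k : ℕ} (h : m + k ≤ n) : (rangeBlock n m k).length = k := by
  rw [← List.length_map (f := Fin.val), map_val_rangeBlock h, List.length_range']

/-- The block lengths are the entries of the index (inside the dimension). -/
theorem map_length_cblocksFrom : ∀ (m : ℕ) (s : List ℕ), m + s.sum ≤ n →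
    (cblocksFrom n m s).map List.length = s
  | _, [], _ => rfl
  | m, k :: s, h => by
    rw [List.sum_cons] at h
    rw [cblocksFrom_cons, List.map_cons, length_rangeBlock (by omega),
      map_length_cblocksFrom (m + k) s (by omega)]

/-- The block lengths of `cblocks n s` are the entries of `s` (inside the dimension). -/
theorem map_length_cblocks {s : List ℕ} (h : s.sum ≤ n) : (cblocks n s).map List.length = s :=
  map_length_cblocksFrom 0 s (by simpa using h)

/-- The concatenation of the blocks, read as naturals, is the range `m, …, m+|s|-1`. -/
theorem map_val_flatten_cblocksFrom : ∀ (m : ℕ) (s : List ℕ), m + s.sum ≤ n →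
    (cblocksFrom n m s).flatten.map Fin.val = List.range' m s.sum
  | m, [], _ => by simp
  | m, k :: s, h => by
    rw [List.sum_cons] at h
    rw [cblocksFrom_cons, List.flatten_cons, List.map_append, map_val_rangeBlock (by omega),
      map_val_flatten_cblocksFrom (m + k) s (by omega), List.sum_cons, List.range'_append_1]

/-- The concatenation of the blocks has no repeated coordinate. -/
theorem nodup_flatten_cblocksFrom (m : ℕ) (s : List ℕ) (h : m + s.sum ≤ n) :
    (cblocksFrom n m s).flatten.Nodup := by
  have hmap := map_val_flatten_cblocksFrom m s h
  have : ((cblocksFrom n m s).flatten.map Fin.val).Nodup := by rw [hmap]; exact List.nodup_range'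
  exact List.Nodup.of_map _ this

/-- Blocks of an index with positive entries are non-empty (inside the dimension). -/
theorem ne_nil_of_mem_cblocksFrom : ∀ (m : ℕ) (s : List ℕ), m + s.sum ≤ n → (∀ i ∈ s, 1 ≤ i) →
    ∀ B ∈ cblocksFrom n m s, B ≠ []
  | _, [], _, _, B, hB => by simp at hB
  | m, k :: s, h, hs, B, hB => by
    rw [List.sum_cons] at h
    rw [cblocksFrom_cons, List.mem_cons] at hB
    rcases hB with rfl | hB
    · have hk : 1 ≤ k := hs k (by simp)
      rw [ne_eq, ← List.length_eq_zero_iff, length_rangeBlock (by omega)]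
      omega
    · exact ne_nil_of_mem_cblocksFrom (m + k) s (by omega) (fun i hi => hs i (by simp [hi])) B hB

/-- Flattening commutes with mapping every block. -/
theorem flatten_map_map {α β : Type*} (f : α → β) (L : List (List α)) :
    (L.map (List.map f)).flatten = L.flatten.map f := by
  induction L with
  | nil => rfl
  | cons B L ih => rw [List.map_cons, List.flatten_cons, List.flatten_cons, ih, List.map_append]

/-! ## Reconstruction of a block pattern from the blocks of its length vector -/

/-- Reading the consecutive blocks (from offset `m`) of the length vector of a block pattern `π`
through any `g` with `g ⟨m + i⟩ = π.flatten[i]` returns `π`. -/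
theorem map_cblocksFrom_eq {α : Type*} :
    ∀ (π : List (List α)) (m : ℕ) (g : Fin n → α) (hm : m + (π.map List.length).sum ≤ n),
      (∀ (i : ℕ) (hi : i < π.flatten.length), g ⟨m + i, by
          rw [List.length_flatten] at hi; omega⟩ = π.flatten[i]) →
      (cblocksFrom n m (π.map List.length)).map (List.map g) = π
  | [], _, _, _, _ => rfl
  | B :: π, m, g, hm, hg => by
    rw [List.map_cons, List.sum_cons] at hm
    rw [List.map_cons, cblocksFrom_cons, List.map_cons]
    congr 1
    · -- the first block is read off as `B`
      apply List.ext_getElem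
      · rw [List.length_map, length_rangeBlock (by omega)]
      · intro i h₁ h₂
        rw [List.getElem_map]
        have hval : ((rangeBlock n m B.length)[i]'(by rwa [List.length_map] at h₁)).val = m + i := by
          have := congrArg (fun L : List ℕ => L[i]?) (map_val_rangeBlock (n := n) (m := m) (k := B.length) (by omega))
          simp only [List.getElem?_map] at this
          rw [List.getElem?_eq_getElem (by rwa [List.length_map] at h₁), List.getElem?_range' (by omega)] at this
          simpa using this
        have hgi := hg i (by simp only [List.flatten_cons, List.length_append]; omega)
        have hin : m + i < n := by omega
        have : (⟨m + i, hin⟩ : Fin n) = (rangeBlock n m B.length)[i]'(by rwa [List.length_map] at h₁) :=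
          Fin.ext hval.symm
        rw [← this, hgi]
        simp [List.getElem_append_left h₂]
    · -- the remaining blocks, from offset `m + |B|`
      refine map_cblocksFrom_eq π (m + B.length) g (by omega) fun i hi => ?_
      have hgi := hg (B.length + i) (by
        simp only [List.flatten_cons, List.length_append]; rw [List.length_flatten] at hi ⊢; omega)
      have e : (⟨m + B.length + i, by rw [List.length_flatten] at hi; omega⟩ : Fin n) =
          ⟨m + (B.length + i), by rw [List.length_flatten] at hi; omega⟩ := Fin.ext (by simp; omega)
      rw [e, hgi]
      simp [List.getElem_append_right (by omega : B.length ≤ B.length + i)]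

/-! ## `gfun` bookkeeping -/

section GFun

variable {N M : ℕ}

/-- `gfun` of the empty pattern. -/
theorem gfun_nil_eq (z : Fin N → ℝ) (c : ℝ) : gfun z c [] = 1 := by rw [gfun]

/-- `gfun` of a pattern with a first block. -/
theorem gfun_cons_eq (z : Fin N → ℝ) (c : ℝ) (B : List (Fin N)) (p : List (List (Fin N))) :
    gfun z c (B :: p) = (c * blockProd z B) / (1 - c * blockProd z B) * gfun z (c * blockProd z B) p := by
  rw [gfun]

/-- `blockProd` under relabelling of coordinates. -/
theorem blockProd_map (z : Fin N → ℝ) (σ : Fin M → Fin N) (B : List (Fin M)) :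
    blockProd z (B.map σ) = blockProd (z ∘ σ) B := by
  simp [blockProd, List.map_map]

/-- `gfun` under relabelling of coordinates. -/
theorem gfun_map (z : Fin N → ℝ) (σ : Fin M → Fin N) :
    ∀ (c : ℝ) (p : List (List (Fin M))), gfun z c (p.map (List.map σ)) = gfun (z ∘ σ) c p := by
  intro c p
  induction p generalizing c with
  | nil => simp
  | cons B p ih => rw [List.map_cons, gfun_cons_eq, gfun_cons_eq, blockProd_map, ih]

end GFun

/-! ## Cumulative block products -/

section Products

/-- Membership in a range block: the coordinates `m ≤ j < m + k`. -/
theorem mem_rangeBlock_iff {m k : ℕ} (h : m + k ≤ n) (j : Fin n) :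
    j ∈ rangeBlock n m k ↔ m ≤ (j : ℕ) ∧ (j : ℕ) < m + k := by
  have hmap := map_val_rangeBlock (n := n) h
  constructor
  · intro hj
    have : (j : ℕ) ∈ (rangeBlock n m k).map Fin.val := List.mem_map.mpr ⟨j, hj, rfl⟩
    rw [hmap, List.mem_range'_1] at this
    exact this
  · intro hj
    have : (j : ℕ) ∈ (rangeBlock n m k).map Fin.val := by rw [hmap, List.mem_range'_1]; exact hj
    obtain ⟨j', hj', hjj'⟩ := List.mem_map.mp this
    rwa [← Fin.ext hjj']

/-- A range block has no repeated coordinate. -/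
theorem nodup_rangeBlock {m k : ℕ} (h : m + k ≤ n) : (rangeBlock n m k).Nodup := by
  have : ((rangeBlock n m k).map Fin.val).Nodup := by rw [map_val_rangeBlock h]; exact List.nodup_range'
  exact List.Nodup.of_map _ this

/-- The product over a range block is the truncated product `∏_{m ≤ j < m+k} x_j`. -/
theorem blockProd_rangeBlock (x : Fin n → ℝ) {m k : ℕ} (h : m + k ≤ n) :
    blockProd x (rangeBlock n m k) =
      ∏ j : Fin n, if m ≤ (j : ℕ) ∧ (j : ℕ) < m + k then x j else 1 := by
  rw [blockProd, ← List.prod_toFinset x (nodup_rangeBlock h), ← Finset.prod_filter]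
  refine Finset.prod_congr ?_ fun _ _ => rfl
  ext j
  simp only [List.mem_toFinset, Finset.mem_filter, Finset.mem_univ, true_and]
  exact mem_rangeBlock_iff h j

/-- Adjacent truncated products multiply: `∏_{m ≤ j < m+k} · ∏_{m+k ≤ j < m+k+l} = ∏_{m ≤ j < m+k+l}`. -/
theorem prod_ite_mul_prod_ite (x : Fin n → ℝ) (m k l : ℕ) :
    (∏ j : Fin n, if m ≤ (j : ℕ) ∧ (j : ℕ) < m + k then x j else 1) *
      (∏ j : Fin n, if m + k ≤ (j : ℕ) ∧ (j : ℕ) < m + k + l then x j else 1) =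
      ∏ j : Fin n, if m ≤ (j : ℕ) ∧ (j : ℕ) < m + k + l then x j else 1 := by
  rw [← Finset.prod_mul_distrib]
  refine Finset.prod_congr rfl fun j _ => ?_
  by_cases h1 : m ≤ (j : ℕ) ∧ (j : ℕ) < m + k
  · rw [if_pos h1, if_neg (by omega), if_pos (by omega), mul_one]
  · rw [if_neg h1]
    by_cases h2 : m + k ≤ (j : ℕ) ∧ (j : ℕ) < m + k + l
    · rw [if_pos h2, if_pos (by omega), one_mul]
    · rw [if_neg h2, if_neg (by omega), one_mul]

/-- **`gfun` of the consecutive blocks is the product of the cumulative block products**: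
`gfun x c (cblocksFrom n m s) = ∏_{l<r} (c Q_{l+1})/(1 − c Q_{l+1})`,
`Q_l = ∏_{m ≤ j < m + s₁+⋯+s_l} x_j`. -/
theorem gfun_cblocksFrom_eq (x : Fin n → ℝ) :
    ∀ (s : List ℕ) (m : ℕ) (c : ℝ), m + s.sum ≤ n →
      gfun x c (cblocksFrom n m s) = ∏ l : Fin s.length,
        (c * ∏ j : Fin n, if m ≤ (j : ℕ) ∧ (j : ℕ) < m + (s.take ((l : ℕ) + 1)).sum then x j else 1) /
          (1 - c * ∏ j : Fin n, if m ≤ (j : ℕ) ∧ (j : ℕ) < m + (s.take ((l : ℕ) + 1)).sum then x j else 1)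
  | [], m, c, _ => by simp
  | k :: s, m, c, h => by
    rw [List.sum_cons] at h
    rw [cblocksFrom_cons, gfun_cons_eq, gfun_cblocksFrom_eq x s (m + k) _ (by omega),
      blockProd_rangeBlock x (by omega : m + k ≤ n), List.length_cons, Fin.prod_univ_succ]
    refine congrArg₂ (· * ·) ?_ ?_
    · have e0 : (List.take (((0 : Fin (s.length + 1)) : ℕ) + 1) (k :: s)).sum = k := by
        simp [List.take_succ_cons]
      rw [e0]
    · refine Finset.prod_congr rfl fun l _ => ?_
      have e : (List.take ((l.succ : ℕ) + 1) (k :: s)).sum = k + (s.take ((l : ℕ) + 1)).sum := by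
        rw [Fin.val_succ, List.take_succ_cons, List.sum_cons]
      rw [e, ← add_assoc, mul_assoc, prod_ite_mul_prod_ite x m k]

end Products

/-! ## The cubical block formula -/

section BlockFormula

/-- Truncated products in the notation of `stub_cubicalPullback`: from offset `0` the cumulative
block products are the truncated products `T M x = ∏_{j<M} x_j`. -/
theorem prod_ite_zero_le (x : Fin n → ℝ) (M : ℕ) :
    (∏ j : Fin n, if 0 ≤ (j : ℕ) ∧ (j : ℕ) < 0 + M then x j else 1) =
      ∏ j : Fin n, if (j : ℕ) < M then x j else 1 := by
  refine Finset.prod_congr rfl fun j _ => ?_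
  by_cases hj : (j : ℕ) < M
  · rw [if_pos hj, if_pos ⟨Nat.zero_le _, by omega⟩]
  · rw [if_neg hj, if_neg (fun h => hj (by omega))]

/-- The partial products of the chart are truncated products: `pprod x i = T (i+1) x`. -/
theorem pprod_eq_tprod (x : Fin n → ℝ) (i : Fin n) :
    pprod x i = ∏ j : Fin n, if (j : ℕ) < (i : ℕ) + 1 then x j else 1 := by
  unfold pprod
  rw [← Finset.prod_filter]
  refine Finset.prod_congr ?_ fun _ _ => rfl
  ext j
  simp only [Finset.mem_filter, Finset.mem_univ, true_and]
  rw [Fin.le_iff_val_le_val]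
  omega

/-- The Jacobian of the chart as a product of truncated products: `∏ⱼ xⱼ^{n-1-j} = ∏ᵢ T i x`. -/
theorem jacobian_eq_prod_tprod (x : Fin n → ℝ) :
    ∏ j : Fin n, x j ^ (n - 1 - (j : ℕ)) =
      ∏ i : Fin n, ∏ j : Fin n, if (j : ℕ) < (i : ℕ) then x j else 1 := by
  rw [← prod_prod_erase_filter_le]
  refine Finset.prod_congr rfl fun i _ => ?_
  rw [← Finset.prod_filter]
  refine Finset.prod_congr ?_ fun _ _ => rfl
  ext j
  simp only [Finset.mem_erase, Finset.mem_filter, Finset.mem_univ, true_and]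
  rw [Fin.le_iff_val_le_val, ne_eq, Fin.ext_iff]
  omega

/-- The cubical pull-back of the word integrand of an index is Kontsevich's integrand at the chart
times the Jacobian, in the notation of `stub_cubicalPullback`. -/
theorem cubicalFun_bword_eq_mzvIntegrand_mul (s : List ℕ) (x : Fin s.sum → ℝ) :
    cubicalFun (bword s.sum s) 1 x =
      KZ.mzvIntegrand s (fun i => ∏ j : Fin s.sum, if (j : ℕ) < (i : ℕ) + 1 then x j else 1) *
        ∏ i : Fin s.sum, ∏ j : Fin s.sum, if (j : ℕ) < (i : ℕ) then x j else 1 := by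
  rw [cubicalFun, jacobian_eq_prod_tprod, wordFun_one_eq_prod_mzvForm]
  congr 1
  unfold KZ.mzvIntegrand
  refine Finset.prod_congr rfl fun i _ => ?_
  rw [cubicalMap_apply, pprod_eq_tprod]
  rfl

/-- **THE CUBICAL BLOCK FORMULA.** For an index `s` with positive entries and `x` off the
coordinate hyperplanes (e.g. in the open cube),
`cubicalFun (bword |s| s) 1 x = gfun x 1 (cblocks |s| s) / ∏ⱼ xⱼ`. -/
theorem cubicalFun_bword_eq_gfun_div : ∀ (s : List ℕ), (∀ a ∈ s, 1 ≤ a) → ∀ (x : Fin s.sum → ℝ), (∀ i, x i ≠ 0) → cubicalFun (bword s.sum s) 1 x = gfun x 1 (cblocks s.sum s) / ∏ j : Fin s.sum, x j := by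
  intro s hs x hx
  -- the tree's blockwise pull-back identity
  have H := Summit.KontsevichZagierPeriods.FurushoPentagon.HoffmanRelationInKZ.stub_cubicalPullback
    s hs (fun (M : ℕ) (y : Fin s.sum → ℝ) => ∏ j : Fin s.sum, if (j : ℕ) < M then y j else 1)
    (fun _ _ => rfl) x hx
  have H' : cubicalFun (bword s.sum s) 1 x = ∏ l : Fin s.length,
      (∏ j : Fin s.sum, if (j : ℕ) < (s.take (l : ℕ)).sum then x j else 1) /
        (1 - ∏ j : Fin s.sum, if (j : ℕ) < (s.take ((l : ℕ) + 1)).sum then x j else 1) := by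
    rw [cubicalFun_bword_eq_mzvIntegrand_mul]; exact H
  rw [H', cblocks, gfun_cblocksFrom_eq x s 0 1 (by simp)]
  simp only [one_mul, prod_ite_zero_le]
  -- telescope: `∏_l T_{p_l} · T_{|s|} = ∏_l T_{p_{l+1}}`
  have hT : ∀ M : ℕ, (∏ j : Fin s.sum, if (j : ℕ) < M then x j else 1) ≠ 0 := fun M =>
    Finset.prod_ne_zero_iff.mpr fun j _ => by split_ifs; exacts [hx j, one_ne_zero]
  -- `f M = T_{(s.take M).sum} x` as a function of a natural number
  set f : ℕ → ℝ := fun M => ∏ j : Fin s.sum, if (j : ℕ) < (s.take M).sum then x j else 1 with hf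
  have hfull : (∏ j : Fin s.sum, x j) = f s.length := by
    simp only [hf, List.take_length]
    exact Finset.prod_congr rfl fun j _ => by rw [if_pos j.2]
  have hf0 : f 0 = 1 := by
    simp only [hf, List.take_zero, List.sum_nil]
    exact Finset.prod_eq_one fun j _ => by rw [if_neg (Nat.not_lt_zero _)]
  have key : (∏ l : Fin s.length, f l) * f s.length = f 0 * ∏ l : Fin s.length, f ((l : ℕ) + 1) := by
    have h1 := Fin.prod_univ_castSucc (fun l : Fin (s.length + 1) => f l)
    have h2 := Fin.prod_univ_succ (fun l : Fin (s.length + 1) => f l)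
    simp only [Fin.val_castSucc, Fin.val_last, Fin.val_zero, Fin.val_succ] at h1 h2
    rw [← h1, h2]
  have htel : (∏ l : Fin s.length, f l) * (∏ j : Fin s.sum, x j) = ∏ l : Fin s.length, f ((l : ℕ) + 1) := by
    rw [hfull, key, hf0, one_mul]
  change (∏ l : Fin s.length, f l / (1 - f ((l : ℕ) + 1))) =
    (∏ l : Fin s.length, f ((l : ℕ) + 1) / (1 - f ((l : ℕ) + 1))) / ∏ j : Fin s.sum, x j
  rw [eq_div_iff (Finset.prod_ne_zero_iff.mpr fun j _ => hx j), Finset.prod_div_distrib,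
    Finset.prod_div_distrib, div_mul_eq_mul_div, htel]

end BlockFormula

end Summit.KontsevichZagierPeriods.MzvKernelInKZ.TwoPosets
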